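import Summits.CriticalPhenomena.PercolationContinuityZ3.Theorems.PercNearOneGluingNoHeavyQuantAtMostR
import Summits.CriticalPhenomena.PercolationContinuityZ3.Theorems.PercNearOneGluingNoHeavyQuantPairCompleting
import Literature.Analysis.Convex.MaclaurinInequality
import HarnessLib

/-!
# QUANT lane R8, Conjecture DIB\* — "at least `r+1` of `n`": the `(r+1)`-COMPLETING / TIED-SIZE family of ANY order `r`, reduced to ONE real
# inequality `E(n, r, 1 − x) ≤ 1` (the ENVELOPE), by the pseudo-blob relaxation + MACLAURIN

builds on p205010 (kernel theorem, internal audit signed; external expert review pending)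

Support file (`--supports stmt-CriticalPhenomena-4575`), QUANT lane typer seat prim-quant-stmt (gen 20).  Theorems only.  Uses `…QuantAtMostR`
(`AMR` calculus, `term_ge_one_sub_amr`), `…QuantPairCompleting` (`one_sub_le_pseudo`; `r = 1` is fully proved there), `Literature.….MaclaurinInequality`.

THE FAMILY.  Conjecture DIB\* restricted to systems in which every non-empty blob has `r·a k ≤ j` and every `r + 1` non-empty blobs together reach
`j + 1` — e.g. ALL TIED systems (every non-empty blob of one size `s`, `r = ⌊j/s⌋`) — reduces (credit `> 2j` ⟹ rates `> 2r`; `N ≥ j+1 ⟸ ≥ r+1` open)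
to: **`P(at most r of n independent events occur) ≤ 1 − x` whenever `Σ φ_x(g k) ≥ 2r`** (DIB\* for unit blobs at layer `r`).

THE CHAIN (`amr_le_envelope`, all kernel): rescale credits to `Σ c = 2r`; `AMR` is monotone in the closure probabilities (`amr_mono`), so pass to
the pseudo system `q = y·t`, `t = 2 − y − c ∈ [1 − y, 2 − y]`; every open factor `1 − y t ≤ 1 − y/2`; regroup by the number `i ≤ r` of open blobs and
pass to the closed sets (`sum_filter_card_le_eq_sum_range`, `sum_powersetCard_sdiff`); MACLAURIN on each `e_{n−i}(t)` with `Σ t = n(2−y) − 2r`: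
`AMR[r, T, q] ≤ y·E(n, r, y)`, **`E(n, r, y) = Σ_{i=0}^{r} C(n,i)·y^{n−1−i}·(1 − y/2)^i·(2 − y − 2r/n)^{n−i}`**.
NUMERICS (seat folder; float sweep `r ≤ 30`, `n ≤ 2r + 200`): `sup E = 0.932` at `(r,n,y) = (1,3,0.45)`; `0.632 (r=2)`, `0.476 (3)`, `0.375 (4)`,
… `0.008 (30)`, always at `y = 1/2`, `n ≈ 3.5 r`.  The envelope inequality is NOT proved here (`r = 1` is settled in `…QuantPairCompleting`).

* `sum_filter_card_le_eq_sum_range`, `sum_powersetCard_sdiff` (bookkeeping); **`Quant.IndepBlob.amr_le_envelope`** — the chain above (relaxed data: credits `c ∈ [0,1]`, `Σ c ≥ 2r`, `q ≤ y(2 − y − c)`, `|T| ≥ 2r + 1`).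
* **`Quant.IndepBlob.amr_le_of_credit`** — `r ≥ 1`, `1/2 ≤ x < 1`, rates summing to `≥ 2r`, envelope hypothesis ⟹ `AMR[r, T, 1 − g] ≤ 1 − x`
  (nonpositive rates discarded; `≤ 2r` positive blobs force `2r ≥ r+1` sure ones, `amr_eq_zero_of_sure`).
* **`Quant.RootDec.term_ge_of_subsetsCompleting`** — the `(r+1)`-COMPLETION CERTIFICATE (TERM rule) modulo the envelope.
* **`Quant.IndepBlob.tail_ge_of_subsetsCompleting`**, **`tail_ge_of_tied_general`** — DIB\* on the family / on all tied systems, modulo the envelope.  [this work];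
Maclaurin [cite: HardyLittlewoodPolya1952, Thm. 52 (§2.22)]; the gluing rows served [cite: KozmaNitzan2024, Conjecture 3 (p. 15)].
-/

namespace Summit.CriticalPhenomena.PercolationContinuityZ3.Theorems

namespace Quant

namespace IndepBlob

open Finset

section Envelope

variable {κ : Type} [DecidableEq κ]

/-- probability that at most `r` blobs of `T` are open, closure probabilities `q` (as in `…QuantAtMostR`) -/
local notation3 "AMR[" r ", " T ", " q "]" =>
  ∑ O ∈ ((T : Finset κ).powerset.filter (fun O => O.card ≤ (r : ℕ))),
    (∏ k ∈ O, (1 - (q : κ → ℝ) k)) * ∏ k ∈ (T : Finset κ) \ O, (q : κ → ℝ) k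

/-! ### 1. Two bookkeeping lemmas: cardinality classes and complements -/

/-- Splitting the sum over `{O ⊆ T : |O| ≤ r}` into cardinality classes. [folklore] -/
theorem sum_filter_card_le_eq_sum_range (T : Finset κ) (F : Finset κ → ℝ) (r : ℕ) :
    ∑ O ∈ T.powerset.filter (fun O => O.card ≤ r), F O = ∑ i ∈ Finset.range (r + 1), ∑ O ∈ T.powersetCard i, F O := by
  induction r with
  | zero =>
    rw [Finset.sum_range_one, Finset.powersetCard_eq_filter]
    refine Finset.sum_congr ?_ fun _ _ => rfl
    ext O; simp only [Finset.mem_filter, Nat.le_zero]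
  | succ r ih =>
    rw [Finset.sum_range_succ, ← ih]
    have hsplit : T.powerset.filter (fun O => O.card ≤ r + 1) =
        T.powerset.filter (fun O => O.card ≤ r) ∪ T.powersetCard (r + 1) := by
      rw [Finset.powersetCard_eq_filter]; ext O; simp only [Finset.mem_filter, Finset.mem_union]
      constructor
      · rintro ⟨hO, hc⟩
        rcases Nat.lt_or_ge O.card (r + 1) with h | h
        · exact Or.inl ⟨hO, by omega⟩
        · exact Or.inr ⟨hO, by omega⟩
      · rintro (⟨hO, hc⟩ | ⟨hO, hc⟩) <;> exact ⟨hO, by omega⟩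
    rw [hsplit, Finset.sum_union]
    rw [Finset.powersetCard_eq_filter, Finset.disjoint_left]
    intro O h1 h2
    have h1' := (Finset.mem_filter.1 h1).2
    have h2' := (Finset.mem_filter.1 h2).2
    omega

/-- Complements: `Σ_{O ∈ T.powersetCard i} G (T ∖ O) = Σ_{C ∈ T.powersetCard (|T| − i)} G C` (`i ≤ |T|`). [folklore] -/
theorem sum_powersetCard_sdiff (T : Finset κ) (G : Finset κ → ℝ) (i : ℕ) (hi : i ≤ T.card) :
    ∑ O ∈ T.powersetCard i, G (T \ O) = ∑ C ∈ T.powersetCard (T.card - i), G C := by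
  refine Finset.sum_nbij' (fun O => T \ O) (fun C => T \ C) ?_ ?_ ?_ ?_ ?_
  · intro O hO
    rcases Finset.mem_powersetCard.1 hO with ⟨hOT, hcard⟩
    exact Finset.mem_powersetCard.2 ⟨Finset.sdiff_subset, by rw [Finset.card_sdiff_of_subset hOT, hcard]⟩
  · intro C hC
    rcases Finset.mem_powersetCard.1 hC with ⟨hCT, hcard⟩
    exact Finset.mem_powersetCard.2 ⟨Finset.sdiff_subset, by rw [Finset.card_sdiff_of_subset hCT, hcard]; omega⟩
  · intro O hO
    exact Finset.sdiff_sdiff_eq_self (Finset.mem_powersetCard.1 hO).1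
  · intro C hC
    exact Finset.sdiff_sdiff_eq_self (Finset.mem_powersetCard.1 hC).1
  · intro O _; rfl

/-! ### 2. The envelope bound for `|T| ≥ 2r + 1` -/

/-- **THE ENVELOPE BOUND (relaxed data).**  `0 < y ≤ 1/2`; a finset `T` with `n = |T| ≥ 2r + 1`; credits `c k ∈ [0,1]` with `Σ_T c ≥ 2r` and closure
probabilities `0 ≤ q k ≤ y·(2 − y − c k)` ⟹
`AMR[r, T, q] ≤ y · Σ_{i=0}^{r} C(n,i)·y^{n−1−i}·(1 − y/2)^i·(2 − y − 2r/n)^{n−i}`.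
Chain: rescale the credits to sum `2r`; `amr_mono` to the pseudo system `q = y·t`, `t = 2 − y − c'`; each open factor `1 − y t ≤ 1 − y/2` (`t ≥ 1 − y ≥ 1/2`); regroup
by the number of open blobs and pass to closed sets; MACLAURIN (`Literature.Analysis.Convex.sum_powersetCard_prod_le`) on each `e_{n−i}(t)` with
`Σ t = n(2 − y) − 2r`. [this work] -/
theorem amr_le_envelope (r : ℕ) (T : Finset κ) (hT : 2 * r + 1 ≤ T.card) (y : ℝ) (hy0 : 0 < y) (hy : y ≤ 1 / 2)
    (q c : κ → ℝ) (hc : ∀ k ∈ T, 0 ≤ c k ∧ c k ≤ 1) (hq : ∀ k ∈ T, 0 ≤ q k ∧ q k ≤ y * (2 - y - c k))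
    (hsum : (2 * r : ℝ) ≤ ∑ k ∈ T, c k) :
    AMR[r, T, q] ≤ y * ∑ i ∈ Finset.range (r + 1),
      (T.card.choose i : ℝ) * y ^ (T.card - 1 - i) * (1 - y / 2) ^ i * (2 - y - 2 * r / T.card) ^ (T.card - i) := by
  set n : ℕ := T.card with hn
  have hn0 : (0 : ℝ) < n := by exact_mod_cast (show 0 < n by omega)
  set C : ℝ := ∑ k ∈ T, c k with hC
  have hC0 : 0 ≤ C := by rw [hC]; exact Finset.sum_nonneg fun k hk => (hc k hk).1
  -- rescaled credits (sum exactly `2r`; `x / 0 = 0` takes care of `C = 0`, which forces `r = 0`)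
  obtain ⟨c', hc'⟩ : ∃ c' : κ → ℝ, ∀ k, c' k = 2 * r * c k / C := ⟨_, fun _ => rfl⟩
  obtain ⟨t, ht⟩ : ∃ t : κ → ℝ, ∀ k, t k = 2 - y - c' k := ⟨_, fun _ => rfl⟩
  obtain ⟨q', hq'⟩ : ∃ q' : κ → ℝ, ∀ k, q' k = y * t k := ⟨_, fun _ => rfl⟩
  have hc'le : ∀ k ∈ T, c' k ≤ c k := fun k hk => by
    rw [hc']
    rcases hC0.eq_or_lt with h0 | hpos
    · rw [← h0, div_zero]; exact (hc k hk).1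
    · rw [div_le_iff₀ hpos]; nlinarith [(hc k hk).1]
  have hc'0 : ∀ k ∈ T, 0 ≤ c' k := fun k hk => by
    rw [hc']; exact div_nonneg (by nlinarith [(hc k hk).1]) hC0
  have hc'1 : ∀ k ∈ T, c' k ≤ 1 := fun k hk => (hc'le k hk).trans (hc k hk).2
  have hc'sum : ∑ k ∈ T, c' k = 2 * r := by
    simp_rw [hc']
    rw [← Finset.sum_div, ← Finset.mul_sum, ← hC]
    rcases hC0.eq_or_lt with h0 | hpos
    · have hr0 : (r : ℝ) = 0 := by
        have h1 : (2 * r : ℝ) ≤ 0 := by rw [h0]; exact hsum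
        have h2 : (0 : ℝ) ≤ r := Nat.cast_nonneg r
        linarith
      rw [← h0, hr0]; simp
    · field_simp
  have ht0 : ∀ k ∈ T, 1 - y ≤ t k := fun k hk => by rw [ht]; linarith [hc'1 k hk]
  have ht0' : ∀ k ∈ T, 0 ≤ t k := fun k hk => by linarith [ht0 k hk]
  have htle : ∀ k ∈ T, t k ≤ 2 - y := fun k hk => by rw [ht]; linarith [hc'0 k hk]
  have hq'1 : ∀ k ∈ T, q' k ≤ 1 := fun k hk => by rw [hq']; nlinarith [htle k hk, ht0' k hk]
  -- (1) monotonicity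
  have hmono : AMR[r, T, q] ≤ AMR[r, T, q'] := by
    refine amr_mono T q q' (fun k hk => ⟨(hq k hk).1, ?_, hq'1 k hk⟩) r
    rw [hq']
    exact (hq k hk).2.trans (mul_le_mul_of_nonneg_left (by rw [ht]; linarith [hc'le k hk]) hy0.le)
  refine hmono.trans ?_
  -- (2) termwise: open factors `≤ (1 − y/2)^{|O|}`, closed factors `= y^{|T∖O|} ∏ t`
  have hterm : ∀ O ∈ T.powerset.filter (fun O => O.card ≤ r),
      (∏ k ∈ O, (1 - q' k)) * ∏ k ∈ T \ O, q' k ≤ (1 - y / 2) ^ O.card * (y ^ (T \ O).card * ∏ k ∈ T \ O, t k) := by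
    intro O hO
    have hOT : O ⊆ T := Finset.mem_powerset.1 (Finset.mem_filter.1 hO).1
    have h1 : ∏ k ∈ O, (1 - q' k) ≤ (1 - y / 2) ^ O.card := by
      rw [← Finset.prod_const]
      refine Finset.prod_le_prod (fun k hk => sub_nonneg.2 (hq'1 k (hOT hk))) fun k hk => ?_
      rw [hq']; nlinarith [ht0 k (hOT hk)]
    have h2 : ∏ k ∈ T \ O, q' k = y ^ (T \ O).card * ∏ k ∈ T \ O, t k := by
      rw [Finset.prod_congr rfl fun k _ => hq' k, Finset.prod_mul_distrib, Finset.prod_const]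
    rw [h2]
    exact mul_le_mul_of_nonneg_right h1 (mul_nonneg (pow_nonneg hy0.le _)
      (Finset.prod_nonneg fun k hk => ht0' k (Finset.mem_sdiff.1 hk).1))
  refine (Finset.sum_le_sum hterm).trans ?_
  -- (3) regroup by cardinality classes and pass to closed sets
  rw [sum_filter_card_le_eq_sum_range]
  have hclass : ∀ i ∈ Finset.range (r + 1),
      ∑ O ∈ T.powersetCard i, (1 - y / 2) ^ O.card * (y ^ (T \ O).card * ∏ k ∈ T \ O, t k) =
        ((1 - y / 2) ^ i * y ^ (n - i)) * ∑ C' ∈ T.powersetCard (n - i), ∏ k ∈ C', t k := by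
    intro i hi
    have hi' : i ≤ n := by have := Finset.mem_range.1 hi; omega
    rw [← sum_powersetCard_sdiff T (fun C' => ∏ k ∈ C', t k) i hi', Finset.mul_sum]
    refine Finset.sum_congr rfl fun O hO => ?_
    rcases Finset.mem_powersetCard.1 hO with ⟨hOT, hcard⟩
    rw [Finset.card_sdiff_of_subset hOT, hcard]
    ring
  rw [Finset.sum_congr rfl hclass]
  -- (4) Maclaurin on each class
  have hsumT : ∑ k ∈ T, t k = (n : ℝ) * (2 - y) - 2 * r := by
    simp_rw [ht]
    rw [Finset.sum_sub_distrib, Finset.sum_const, hc'sum, nsmul_eq_mul]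
  have hmac : ∀ i ∈ Finset.range (r + 1), ∑ C' ∈ T.powersetCard (n - i), ∏ k ∈ C', t k ≤
      (n.choose i : ℝ) * (2 - y - 2 * r / n) ^ (n - i) := by
    intro i hi
    have hi' : i ≤ n := by have := Finset.mem_range.1 hi; omega
    have h := Literature.Analysis.Convex.sum_powersetCard_prod_le T t ht0' (n - i)
    rw [hsumT, Nat.choose_symm hi'] at h
    have e : ((n : ℝ) * (2 - y) - 2 * r) / n = 2 - y - 2 * r / n := by field_simp
    rw [e] at h
    exact h
  have hcoef : ∀ i ∈ Finset.range (r + 1), 0 ≤ (1 - y / 2) ^ i * y ^ (n - i) := fun i _ =>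
    mul_nonneg (pow_nonneg (by linarith) _) (pow_nonneg hy0.le _)
  calc ∑ i ∈ Finset.range (r + 1), ((1 - y / 2) ^ i * y ^ (n - i)) * ∑ C' ∈ T.powersetCard (n - i), ∏ k ∈ C', t k
      ≤ ∑ i ∈ Finset.range (r + 1), ((1 - y / 2) ^ i * y ^ (n - i)) * ((n.choose i : ℝ) * (2 - y - 2 * r / n) ^ (n - i)) :=
        Finset.sum_le_sum fun i hi => mul_le_mul_of_nonneg_left (hmac i hi) (hcoef i hi)
    _ = y * ∑ i ∈ Finset.range (r + 1), (n.choose i : ℝ) * y ^ (n - 1 - i) * (1 - y / 2) ^ i * (2 - y - 2 * r / n) ^ (n - i) := by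
        rw [Finset.mul_sum]
        refine Finset.sum_congr rfl fun i hi => ?_
        have hi' : n - i = (n - 1 - i) + 1 := by have := Finset.mem_range.1 hi; omega
        rw [hi', pow_succ]
        ring

end Envelope

end IndepBlob

end Quant

end Summit.CriticalPhenomena.PercolationContinuityZ3.Theorems

namespace Summit.CriticalPhenomena.PercolationContinuityZ3.Theorems

namespace Quant

namespace IndepBlob

open Finset

section CreditR

variable {κ : Type} [DecidableEq κ]

/-- probability that at most `r` blobs of `T` are open, closure probabilities `q` (as in `…QuantAtMostR`) -/
local notation3 "AMR[" r ", " T ", " q "]" =>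
  ∑ O ∈ ((T : Finset κ).powerset.filter (fun O => O.card ≤ (r : ℕ))),
    (∏ k ∈ O, (1 - (q : κ → ℝ) k)) * ∏ k ∈ (T : Finset κ) \ O, (q : κ → ℝ) k

/-! ### 3. From credit rates to `AMR ≤ 1 − x`, modulo the envelope inequality -/

/-- **AT LEAST `r + 1` OF `n`, MODULO THE ENVELOPE INEQUALITY.**  `r ≥ 1`, `1/2 ≤ x < 1`; independent events `k ∈ T` with probabilities
`g k ∈ [0,1]` and credit rates summing to `≥ 2r`; IF the envelope inequality
`E(n, r, y) = Σ_{i ≤ r} C(n,i) y^{n−1−i} (1 − y/2)^i (2 − y − 2r/n)^{n−i} ≤ 1` holds at `y = 1 − x` for every `n ≥ 2r + 1`, THEN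
`P(at most r of them occur) = AMR[r, T, 1 − g] ≤ 1 − x`.  (Numerically `E ≤ 1` for all `r ≥ 1`, `n ≥ 2r+1`, `y ≤ 1/2` — maximum `0.932` at
`(r, n, y) = (1, 3, 0.45)`, `0.632` for `r = 2`, decreasing in `r` (seat folder, kit j131100 + local table); proved in the tree for no `r` yet in this form —
`r = 1` is `amo_le_of_credit` by a sharper envelope.) [this work] -/
theorem amr_le_of_credit (r : ℕ) (hr : 1 ≤ r) (x : ℝ) (hx : 1 / 2 ≤ x) (hx1 : x < 1) (T : Finset κ) (g : κ → ℝ)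
    (hg : ∀ k ∈ T, 0 ≤ g k ∧ g k ≤ 1)
    (hcr : (2 * r : ℝ) ≤ ∑ k ∈ T, (if x ≤ g k then g k else (g k - x ^ 2) / (1 - x)))
    (hE : ∀ n : ℕ, 2 * r + 1 ≤ n → ∑ i ∈ Finset.range (r + 1),
      (n.choose i : ℝ) * (1 - x) ^ (n - 1 - i) * (1 - (1 - x) / 2) ^ i * (2 - (1 - x) - 2 * r / n) ^ (n - i) ≤ 1) :
    AMR[r, T, fun k => 1 - g k] ≤ 1 - x := by
  set φ : κ → ℝ := fun k => if x ≤ g k then g k else (g k - x ^ 2) / (1 - x) with hφ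
  set T' := T.filter (fun k => 0 < φ k) with hT'
  have hsub : T' ⊆ T := Finset.filter_subset _ _
  have hcr' : (2 * r : ℝ) ≤ ∑ k ∈ T', φ k := by
    have hsplit := Finset.sum_filter_add_sum_filter_not T (fun k => 0 < φ k) φ
    have hneg : ∑ k ∈ T.filter (fun k => ¬ 0 < φ k), φ k ≤ 0 :=
      Finset.sum_nonpos fun k hk => not_lt.1 (Finset.mem_filter.1 hk).2
    have hcrT : (2 * r : ℝ) ≤ ∑ k ∈ T, φ k := hcr
    linarith
  have hpos : ∀ k ∈ T', 0 < φ k := fun k hk => (Finset.mem_filter.1 hk).2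
  have hq : ∀ k ∈ T, 0 ≤ 1 - g k ∧ 1 - g k ≤ 1 := fun k hk => ⟨by linarith [(hg k hk).2], by linarith [(hg k hk).1]⟩
  refine (amr_le_of_subset r T' T hsub (fun k => 1 - g k) hq).trans ?_
  have hφ1 : ∀ k ∈ T, φ k ≤ 1 := fun k hk => creditRate_le_one x (g k) hx1 (hg k hk).2
  rcases Nat.lt_or_ge T'.card (2 * r + 1) with hlt | hge
  · -- at most `2r` positive-credit blobs: then exactly `2r`, all sure
    have hcardR : (T'.card : ℝ) ≤ 2 * r := by exact_mod_cast (show T'.card ≤ 2 * r by omega)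
    have hall : ∀ k ∈ T', φ k = 1 := by
      intro k hk
      by_contra hne
      have hlt1 : φ k < 1 := lt_of_le_of_ne (hφ1 k (hsub hk)) hne
      have h1 : ∑ l ∈ T'.erase k, φ l ≤ (T'.erase k).card • (1 : ℝ) :=
        Finset.sum_le_card_nsmul _ _ _ fun l hl => hφ1 l (hsub (Finset.mem_of_mem_erase hl))
      rw [nsmul_eq_mul, mul_one, Finset.card_erase_of_mem hk] at h1
      have h2 := Finset.add_sum_erase T' φ hk
      have h3 : ((T'.card - 1 : ℕ) : ℝ) ≤ 2 * r - 1 := by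
        have : T'.card - 1 + 1 ≤ 2 * r := by
          have hT'pos : 0 < T'.card := Finset.card_pos.2 ⟨k, hk⟩
          omega
        have : ((T'.card - 1 : ℕ) : ℝ) + 1 ≤ 2 * r := by exact_mod_cast this
        linarith
      linarith
    have hg1 : ∀ k ∈ T', g k = 1 := by
      intro k hk
      have h := hall k hk
      by_cases hxg : x ≤ g k
      · have : φ k = g k := by simp only [hφ]; rw [if_pos hxg]
        linarith
      · exfalso
        have : φ k = (g k - x ^ 2) / (1 - x) := by simp only [hφ]; rw [if_neg hxg]
        rw [this, div_eq_one_iff_eq (by linarith : (1 : ℝ) - x ≠ 0)] at h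
        nlinarith [not_le.1 hxg]
    have hcard : r + 1 ≤ T'.card := by
      have hb : ∑ k ∈ T', φ k ≤ T'.card • (1 : ℝ) := Finset.sum_le_card_nsmul _ _ _ fun k hk => hφ1 k (hsub hk)
      rw [nsmul_eq_mul, mul_one] at hb
      have : (2 * r : ℝ) ≤ T'.card := hcr'.trans hb
      have : 2 * r ≤ T'.card := by exact_mod_cast this
      omega
    obtain ⟨S, hST', hScard⟩ := Finset.exists_subset_card_eq hcard
    rw [amr_eq_zero_of_sure r S T' hST' hScard (fun k => 1 - g k) (fun k hk => hq k (hsub hk))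
      (fun k hk => by simp [hg1 k (hST' hk)])]
    linarith
  · -- `2r + 1` or more: the envelope
    have henv := amr_le_envelope r T' hge (1 - x) (by linarith) (by linarith) (fun k => 1 - g k) φ
      (fun k hk => ⟨(hpos k hk).le, hφ1 k (hsub hk)⟩)
      (fun k hk => ⟨(hq k (hsub hk)).1, one_sub_le_pseudo x (g k) (by linarith) hx1⟩) hcr'
    have hEn := hE T'.card hge
    have hy0 : 0 ≤ 1 - x := by linarith
    calc AMR[r, T', fun k => 1 - g k] ≤ (1 - x) * _ := henv
      _ ≤ (1 - x) * 1 := mul_le_mul_of_nonneg_left hEn hy0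
      _ = 1 - x := mul_one _

end CreditR

end IndepBlob

namespace RootDec

open Finset

variable {κ : Type} [Fintype κ] [DecidableEq κ]

/-- product-Bernoulli weight of the set `W` of open blobs (as in `…QuantRootReduction`) -/
local notation3 "wt[" g ", " W "]" => ∏ k, (if k ∈ (W : Finset κ) then (g : κ → ℝ) k else 1 - (g : κ → ℝ) k)

/-- the TERM tail `P(s + Σ_{k open} a k ≥ j+1)` (as in `…QuantRootReduction`) -/
local notation3 "TERM[" s ", " a ", " g ", " j "]" =>
  ∑ W : Finset κ, wt[g, W] * (if (j : ℕ) + 1 ≤ (s : ℕ) + ∑ k ∈ W, (a : κ → ℕ) k then (1 : ℝ) else 0)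

/-- **THE `(r+1)`-COMPLETION CERTIFICATE (TERM rule), modulo the envelope inequality.**  Gates in `[0,1]`, `1/2 ≤ x < 1`, `r ≥ 1`; a finset `T` every
`(r+1)`-subset of which completes at the sure part `s`, with credit rates summing to `≥ 2r` ⟹ `x ≤ TERM[s, a, g, j]`, provided `E(n, r, 1 − x) ≤ 1` for all
`n ≥ 2r + 1`. [this work] -/
theorem term_ge_of_subsetsCompleting (r : ℕ) (hr : 1 ≤ r) (s : ℕ) (a : κ → ℕ) (g : κ → ℝ) (j : ℕ) (hg : ∀ k, 0 ≤ g k ∧ g k ≤ 1)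
    (T : Finset κ) (hcomp : ∀ U ∈ T.powersetCard (r + 1), j + 1 ≤ s + ∑ k ∈ U, a k) (x : ℝ) (hx : 1 / 2 ≤ x) (hx1 : x < 1)
    (hcr : (2 * r : ℝ) ≤ ∑ k ∈ T, (if x ≤ g k then g k else (g k - x ^ 2) / (1 - x)))
    (hE : ∀ n : ℕ, 2 * r + 1 ≤ n → ∑ i ∈ Finset.range (r + 1),
      (n.choose i : ℝ) * (1 - x) ^ (n - 1 - i) * (1 - (1 - x) / 2) ^ i * (2 - (1 - x) - 2 * r / n) ^ (n - i) ≤ 1) :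
    x ≤ TERM[s, a, g, j] := by
  have h1 := term_ge_one_sub_amr g j hg T r s a hcomp
  have h2 := IndepBlob.amr_le_of_credit r hr x hx hx1 T g (fun k _ => hg k) hcr hE
  linarith

end RootDec

namespace IndepBlob

open Finset

/-- **DIB\* ON THE `(r+1)`-COMPLETING CLASS WITH SIZES `≤ j/r`, modulo the envelope inequality** (`r ≥ 1`, every floor `1/2 ≤ x < 1`, any number of
blobs): gates in `[0,1]`; every non-empty blob has `r·a k ≤ j`; every `r + 1` non-empty blobs together reach `j + 1`; credit `Σ a k·φ_x(g k) > 2j`; and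
`E(n, r, 1 − x) ≤ 1` for `n ≥ 2r + 1` ⟹ `x ≤ P(N ≥ j+1)`.  (`r = 1` with the envelope discharged is `tail_ge_of_pairCompleting`.) [this work] -/
theorem tail_ge_of_subsetsCompleting (r : ℕ) (hr : 1 ≤ r) (x : ℝ) (hx : 1 / 2 ≤ x) (hx1 : x < 1) {ι : Type} [Fintype ι] [DecidableEq ι]
    (a : ι → ℕ) (g : ι → ℝ) (j : ℕ) (hg : ∀ k, 0 ≤ g k ∧ g k ≤ 1) (hsize : ∀ k, 0 < a k → r * a k ≤ j)
    (hcomp : ∀ U : Finset ι, U.card = r + 1 → (∀ k ∈ U, 0 < a k) → j + 1 ≤ ∑ k ∈ U, a k)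
    (hcredit : (2 * j : ℝ) < ∑ k, (a k : ℝ) * (if x ≤ g k then g k else (g k - x ^ 2) / (1 - x)))
    (hE : ∀ n : ℕ, 2 * r + 1 ≤ n → ∑ i ∈ Finset.range (r + 1),
      (n.choose i : ℝ) * (1 - x) ^ (n - 1 - i) * (1 - (1 - x) / 2) ^ i * (2 - (1 - x) - 2 * r / n) ^ (n - i) ≤ 1) :
    x ≤ ∑ W : Finset ι, (∏ k, if k ∈ W then g k else 1 - g k) * (if j + 1 ≤ ∑ k ∈ W, a k then (1 : ℝ) else 0) := by
  have hT : (∑ W : Finset ι, (∏ k, if k ∈ W then g k else 1 - g k) * (if j + 1 ≤ 0 + ∑ k ∈ W, a k then (1 : ℝ) else 0)) =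
      ∑ W : Finset ι, (∏ k, if k ∈ W then g k else 1 - g k) * (if j + 1 ≤ ∑ k ∈ W, a k then (1 : ℝ) else 0) :=
    Finset.sum_congr rfl fun W _ => by rw [zero_add]
  set φ : ι → ℝ := fun k => if x ≤ g k then g k else (g k - x ^ 2) / (1 - x) with hφ
  set T := Finset.univ.filter (fun k => 0 < a k ∧ 0 < φ k) with hTdef
  -- the credit lives on `T`, where `r·a ≤ j`
  have hsplit := Finset.sum_filter_add_sum_filter_not (Finset.univ : Finset ι) (fun k => 0 < a k ∧ 0 < φ k)
    (fun k => (a k : ℝ) * φ k)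
  have hrest : ∑ k ∈ Finset.univ.filter (fun k => ¬ (0 < a k ∧ 0 < φ k)), (a k : ℝ) * φ k ≤ 0 := by
    refine Finset.sum_nonpos fun k hk => ?_
    have h := (Finset.mem_filter.1 hk).2
    by_cases ha : 0 < a k
    · have hφk : φ k ≤ 0 := not_lt.1 fun h' => h ⟨ha, h'⟩
      exact mul_nonpos_iff.2 (Or.inl ⟨Nat.cast_nonneg _, hφk⟩)
    · have : a k = 0 := by omega
      rw [this, Nat.cast_zero, zero_mul]
  have hTj : (r : ℝ) * ∑ k ∈ T, (a k : ℝ) * φ k ≤ (j : ℝ) * ∑ k ∈ T, φ k := by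
    rw [Finset.mul_sum, Finset.mul_sum]
    refine Finset.sum_le_sum fun k hk => ?_
    have hk' := (Finset.mem_filter.1 hk).2
    have hsz : (r : ℝ) * a k ≤ j := by exact_mod_cast hsize k hk'.1
    nlinarith [hk'.2]
  have hr0 : (0 : ℝ) < r := by exact_mod_cast hr
  have hcrT : (j : ℝ) * (2 * r) < (j : ℝ) * ∑ k ∈ T, φ k := by nlinarith
  have hcr : (2 * r : ℝ) ≤ ∑ k ∈ T, φ k := (lt_of_mul_lt_mul_left hcrT (Nat.cast_nonneg j)).le
  have key := RootDec.term_ge_of_subsetsCompleting r hr 0 a g j hg T (fun U hU => by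
    rcases Finset.mem_powersetCard.1 hU with ⟨hUT, hcard⟩
    have := hcomp U hcard fun k hk => (Finset.mem_filter.1 (hUT hk)).2.1
    omega) x hx hx1 hcr hE
  rw [hT] at key
  exact key

/-- **DIB\* for TIED blobs of any size, modulo the envelope inequality**: every non-empty blob has size `s` with `r·s ≤ j < (r+1)·s` (`r ≥ 1`); gates in
`[0,1]`, credit `> 2j`, `1/2 ≤ x < 1`, and `E(n, r, 1 − x) ≤ 1` for `n ≥ 2r + 1` ⟹ `x ≤ P(N ≥ j+1)`. [this work] -/
theorem tail_ge_of_tied_general (r : ℕ) (hr : 1 ≤ r) (x : ℝ) (hx : 1 / 2 ≤ x) (hx1 : x < 1) {ι : Type} [Fintype ι] [DecidableEq ι]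
    (a : ι → ℕ) (g : ι → ℝ) (j s : ℕ) (hs : r * s ≤ j) (hs' : j + 1 ≤ (r + 1) * s) (htied : ∀ k, a k = 0 ∨ a k = s)
    (hg : ∀ k, 0 ≤ g k ∧ g k ≤ 1)
    (hcredit : (2 * j : ℝ) < ∑ k, (a k : ℝ) * (if x ≤ g k then g k else (g k - x ^ 2) / (1 - x)))
    (hE : ∀ n : ℕ, 2 * r + 1 ≤ n → ∑ i ∈ Finset.range (r + 1),
      (n.choose i : ℝ) * (1 - x) ^ (n - 1 - i) * (1 - (1 - x) / 2) ^ i * (2 - (1 - x) - 2 * r / n) ^ (n - i) ≤ 1) :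
    x ≤ ∑ W : Finset ι, (∏ k, if k ∈ W then g k else 1 - g k) * (if j + 1 ≤ ∑ k ∈ W, a k then (1 : ℝ) else 0) := by
  refine tail_ge_of_subsetsCompleting r hr x hx hx1 a g j hg (fun k hk => ?_) (fun U hU hpos => ?_) hcredit hE
  · rcases htied k with h | h
    · omega
    · rw [h]; exact hs
  · have hall : ∀ k ∈ U, a k = s := fun k hk => by
      rcases htied k with h | h
      · exact absurd h (by have := hpos k hk; omega)
      · exact h
    rw [Finset.sum_congr rfl hall, Finset.sum_const, hU, smul_eq_mul]
    exact hs'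

end IndepBlob

end Quant

end Summit.CriticalPhenomena.PercolationContinuityZ3.Theorems
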